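import Summits.ResolutionOfSingularities.ResolutionOfSingularities.Theorems.FrobeniusClosingPatchingRelPerfectDepthTaylorFlag
import Literature.AlgebraicGeometry.Resolution.MarkedIdealsEtale
import Literature.AlgebraicGeometry.Limits.IdealSheafExtension
import HarnessLib

/-!
# Crux `PatchingRelPerfect` (stmt-ResolutionOfSingularities-16161), chain W5.2 — the Taylor coefficient flag RESTRICTS
# to `r`-saturated open pieces of a retraction pair

[OURS · L1 W5.2 · rung tool] res-L1-w52-lead-1's coefficient flag `DepthGraded.coeffFlag k r a J`
(`…DepthTaylorFlag`) of an ideal sheaf `J` on `V` along a retraction pair `k : W ⟶ V`, `r : V ⟶ W` is built from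
`⊔`, `⊓`, the colon, `ker k` and inverse images; all of these commute with restriction to open pieces, so for open
an open immersion `ιV : V' ⟶ V` and any `ιW : W' ⟶ W` carrying a restricted pair `k' : W' ⟶ V'`, `r' : V' ⟶ W'`
(`k' ≫ ιV = ιW ≫ k` CARTESIAN — i.e. `W' = k⁻¹V'`, automatic for `V' = r⁻¹W'` — and `r' ≫ ιW = ιV ≫ r`):

* `DepthGraded.taylorShift_comap` — `(taylorShift k r J)|_{V'} = taylorShift k' r' (J|_{V'})`;
* `DepthGraded.taylorShiftIter_comap`, **`DepthGraded.coeffFlag_comap`** — `(coeffFlag k r a J)|_{W'} =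
  coeffFlag k' r' a (J|_{V'})`.

This is what lets the GLOBAL flag of the initial state `(X₁ = Bl_𝔪 Spec S ⊇ E = ℙᵐ_{κ₀}, i, r₀)` be computed on
the affine charts `Spec (S[𝔪t]_{y_j t})₀ ⊇ Spec (κ₀[T]_{T_j})₀` by lead-1's `ideal_top_coeffFlag_eq_coeffIdeal_comap`
(`…DepthTaylorFlagComap`). Also: `ker_eq_comap_of_isPullback`.
Fact-free; `V`, `V'` locally Noetherian (sections of the colon), `k` quasi-compact (sections of `ker k`).
Rung tool of OUR route; nothing here is a statement of the manuscript under review; AI-written, weaker than expert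
review.

## References
* H. Kawanoue, K. Matsuki, *Resolution of singularities of an idealistic filtration in dimension 3 after
  Benito–Villamayor*, Adv. Stud. Pure Math. 70 (2016), §2. [KawanoueMatsuki2016]
* H. Matsumura, *Commutative Ring Theory* (1986), Thm. 7.4 (iii) (colon ideals and flat base change). [Matsumura1987]
-/

-- `Summit.<Summit>.<Sub>.Theorems` with `Sub = Summit` (single-conjunct summit, D-0017)
set_option linter.dupNamespace false

noncomputable section

open CategoryTheory CategoryTheory.Limits AlgebraicGeometry TopologicalSpace
open Literature.AlgebraicGeometry.Resolution
open Scheme.IdealSheafData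

namespace Summit.ResolutionOfSingularities.ResolutionOfSingularities.Theorems

universe u

namespace DepthGraded

/-! ## §1 A restriction lemma for kernel ideal sheaves -/

/-- **The kernel ideal sheaf of a base change along an open immersion is the restricted kernel**: for a
cartesian square `f' ≫ iV = iU ≫ f` with `iV` an open immersion and `f` quasi-compact, `ker f' = (ker f)|_V`.
[cite: StacksProject, Tag 081I] -/
theorem ker_eq_comap_of_isPullback {X Y U V : Scheme.{u}} {f : X ⟶ Y} {f' : U ⟶ V} {iU : U ⟶ X}
    {iV : V ⟶ Y} [IsOpenImmersion iV] [QuasiCompact f] (H : IsPullback f' iU iV f) :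
    f'.ker = f.ker.comap iV := by
  refine Scheme.IdealSheafData.ext (funext fun W => ?_)
  rw [Scheme.ker_ideal_of_isPullback_of_isOpenImmersion f f' iU iV H W, ideal_comap_of_isOpenImmersion]

/-! ## §2 The Taylor shift and the coefficient flag restrict to open pieces -/

section Restrict

variable {W V W' V' : Scheme.{u}} {k : W ⟶ V} {r : V ⟶ W} {k' : W' ⟶ V'} {r' : V' ⟶ W'}
  {ιW : W' ⟶ W} {ιV : V' ⟶ V} [IsOpenImmersion ιV] [QuasiCompact k]
  [IsLocallyNoetherian V] [IsLocallyNoetherian V']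
  (hk : IsPullback k' ιW ιV k) (hr : r' ≫ ιW = ιV ≫ r)

include hk hr in
/-- [OURS · L1 W5.2] **The Taylor shift restricts**: `(taylorShift k r J)|_{V'} = taylorShift k' r' (J|_{V'})`
for a restricted retraction pair on open pieces (`W' = k⁻¹V'` cartesian, `r' ≫ ιW = ιV ≫ r`).
[cite: KawanoueMatsuki2016, §2] [cite: Matsumura1987, Thm. 7.4 (iii)] -/
theorem taylorShift_comap (J : V.IdealSheafData) :
    (taylorShift k r J).comap ιV = taylorShift k' r' (J.comap ιV) := by
  have hkk : k' ≫ ιV = ιW ≫ k := hk.w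
  have h1 : ((J.comap k).comap r).comap ιV = ((J.comap ιV).comap k').comap r' := by
    rw [← comap_comp, ← hr, comap_comp, ← comap_comp J ιW k, ← hkk, comap_comp]
  rw [taylorShift, taylorShift, comap_colon_of_flat ιV,
    Literature.AlgebraicGeometry.Limits.comap_inf_of_isOpenImmersion,
    Scheme.IdealSheafData.comap_sup, h1, ← ker_eq_comap_of_isPullback hk]

include hk hr in
/-- [OURS · L1 W5.2] The iterated Taylor shift restricts. [cite: KawanoueMatsuki2016, §2] -/
theorem taylorShiftIter_comap (a : ℕ) :
    ∀ J : V.IdealSheafData, (taylorShiftIter k r a J).comap ιV = taylorShiftIter k' r' a (J.comap ιV) := by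
  induction a with
  | zero => intro J; rfl
  | succ a ih =>
    intro J
    rw [taylorShiftIter_succ, taylorShiftIter_succ, ih, taylorShift_comap hk hr]

include hk hr in
/-- [OURS · L1 W5.2] **The coefficient flag restricts to open pieces**: `(coeffFlag k r a J)|_{W'} =
coeffFlag k' r' a (J|_{V'})` for a restricted retraction pair (`k' ≫ ιV = ιW ≫ k` cartesian, `r' ≫ ιW = ιV ≫ r`).
With `W'`, `V'` affine this feeds lead-1's `ideal_top_coeffFlag_eq_coeffIdeal_comap`: the GLOBAL flag of a state
of the chain is computed chart by chart as coefficient ideals of pulled-back polynomial ideals.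
[cite: KawanoueMatsuki2016, §2] -/
theorem coeffFlag_comap (a : ℕ) (J : V.IdealSheafData) :
    (coeffFlag k r a J).comap ιW = coeffFlag k' r' a (J.comap ιV) := by
  have hkk : k' ≫ ιV = ιW ≫ k := hk.w
  rw [coeffFlag, coeffFlag, ← comap_comp, ← hkk, comap_comp, taylorShiftIter_comap hk hr]

end Restrict


/-! ## §3 The pair `(k ≫ topIso⁻¹, ⊤.ι ≫ r)` on the open `⊤` has the same flag -/

/-- [OURS · L1 W5.2] **Moving a global retraction pair onto the open `V = ⊤`** (the carrier of the formats `GradedFormat` /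
`FlagFormat` is an OPEN of `X`): for `k : E ⟶ X`, `r : X ⟶ E`, the pair `(k ≫ topIso⁻¹, ⊤.ι ≫ r)` on `↑⊤` has
`coeffFlag (k ≫ topIso⁻¹) (⊤.ι ≫ r) a (J|_⊤) = coeffFlag k r a J` (restriction along the isomorphism `⊤.ι`).
[cite: KawanoueMatsuki2016, §2] -/
theorem coeffFlag_topPair {E X : Scheme.{u}} [IsLocallyNoetherian X] (k : E ⟶ X) [QuasiCompact k] (r : X ⟶ E)
    (a : ℕ) (J : X.IdealSheafData) :
    coeffFlag (k ≫ X.topIso.inv) ((⊤ : X.Opens).ι ≫ r) a (J.comap (⊤ : X.Opens).ι) = coeffFlag k r a J := by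
  haveI : IsIso (⊤ : X.Opens).ι := by rw [← Scheme.topIso_hom]; infer_instance
  have hsq : IsPullback (k ≫ X.topIso.inv) (𝟙 E) (⊤ : X.Opens).ι k :=
    IsPullback.of_vert_isIso ⟨by rw [Category.assoc, Scheme.toIso_inv_ι, Category.comp_id, Category.id_comp]⟩
  have h := coeffFlag_comap hsq
    (show ((⊤ : X.Opens).ι ≫ r) ≫ 𝟙 E = (⊤ : X.Opens).ι ≫ r from Category.comp_id _) a J
  rw [Scheme.IdealSheafData.comap_id] at h
  exact h.symm

end DepthGraded

end Summit.ResolutionOfSingularities.ResolutionOfSingularities.Theorems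

end
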